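import Summits.Ventures.CertifiedManyBodySolver.Observables.CrutchODLROFloor
import Literature.MathematicalPhysics.QuantumLattice.GibbsVariationalPrinciple
import HarnessLib

/-!
# BCS-crutch ODLRO floor at POSITIVE TEMPERATURE (card `bcs-crutch-odlro-floor`, P1-GC-β)

HONEST FRAMING: first certified bounds; not a superconductivity verdict; every number certified or labelled
float. WHAT THIS IS NOT: a statement about the Hubbard model — `H_g = K_L − μN − (g/L²) Δ_d†Δ_d` is the
BCS-CRUTCH Hamiltonian `crutchTorusTT'` of `Observables/CrutchODLROFloor.lean` (p484664); at `g = 0` NOTHING is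
claimed — and at `g = 0`, `T > 0`, thermal pair LRO is forbidden in `d = 2` (barrier
`not_hasTorusLRO_thermal_dWave`, `HohenbergMerminWagnerPairing`): the thermal floor below can exist only because
the crutch term `−(g/L²)Δ_d†Δ_d` is infinite-range — neither finite-range hopping nor a function of number
operators, i.e. outside `PositiveTemperaturePairFieldOrder`'s class. Not a `T_c` of anything physical; grand
canonical at one `μ`, density NOT pinned; the numbers of the corollary column are READINGS — no number enters a
statement here. Sequel of `CrutchODLROFloor.lean` (the `T = 0` floor P1-GC); this file is its `T > 0` twin.

THE T > 0 TWIN OF P1-GC (hubbard-pc-lens-finite-1 g5, card ADDENDUM g5; critic-2 binding verdict on the card: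
SURVIVES as instrument-reading / typed corollary). The SAME two `T = 0` cells as P1-GC — zero-field floor
`lo·L² ≤ E₀(K_L − μN)` and sourced cap `E₀(A_L(h₀)) ≤ hi·L²` (`Rows/SourcedTorusRows`) — give, for every `g > 0`
and every `β > 0`, a floor on the THERMAL pair-ODLRO density of the crutch Gibbs state `ω_{β,g} = e^{−βH_g}/Z`:

  `u_β := Re ω_{β,g}(Δ_d†Δ_d)/L⁴ ≥ (lo − hi − h₀²/g − (log 4)/β)/g`     (`crutchThermalODLROFloorGC_holds`).

Chain (four tree facts, nothing else): `lo·L² ≤ E₀(A(0))` (cell) `≤ Re ω_{β,g}(A(0))` (a Gibbs state is a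
state: `A(0) − E₀ ⪰ 0`, `gibbsState_nonneg_of_posSemidef`) `= Re ω_{β,g}(H_g) + (g/L²) Re ω_{β,g}(Δ_d†Δ_d)`
(linearity) `≤ E₀(H_g) + log(dim Fock)/β + (g/L²)·X` (energy–entropy bound `Matrix.re_gibbsState_hamiltonian_le`,
`dim Fock = 4^{L²}`) and `E₀(H_g) ≤ E₀(A(h₀)) + h₀²L²/g ≤ hi·L² + h₀²L²/g` (the landed square
`groundEnergy_crutch_le ∘ crutchLeSourcedAdd_of_pos` + cap cell). The exchange rate `log 4` per site between
`T = 0` energy cells and `T > 0` statements is the ThermalWedge route's entropy sandwich read in the opposite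
direction (there: `T > 0` control ⇒ `T = 0` facts; here: `T = 0` certificates ⇒ a `T > 0` floor). Corollary
arithmetic (pure `ℝ`): the floor is positive iff `g > g₀(β) = h₀²/(G − log 4/β)` for `β > log 4/G`, `G = lo − hi`
(`thermalCrutchFloor_pos_iff`, `↓ g₀ = h₀²/G` of P1-GC as `β → ∞`), equivalently at fixed `g > g₀` for every
`β > log 4/(G − h₀²/g)` (`thermalCrutchFloor_pos_of_beta`). By-name reader on two uniform cells with their own
`(q, L₀)`: `crutchThermalODLROFloor_of_rows` (the T > 0 instances on the node pairs of
`Certificates/…_pinning_crutchODLROFloor_gc_of_nodes.lean` are one application each, with a `β` binder).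

NOTHING IS ASSERTED about any model constant: every bound-valued statement is a `def … : Prop` or takes the two
cells as hypotheses. No `sorry`, no named fact. The two generic Gibbs-state helpers are `private` copies of
tree statements (`HubbardLadder.Bounds.groundEnergy_le_re_gibbsState` / `…re_gibbsState_self_le_groundEnergy_add`,
`Observables.SourcedGibbsTrialCap`'s `groundEnergy_le_re_gibbsState`) kept local to spare the imports. Seat-side
sketch of record: `pub/hubbard-cq/lean/finite1-CrutchFloorThermal.lean` (sha16 fb5f6edba04894a1), landed by
hubbard-cq-p2.

References: J. Bardeen, L. N. Cooper, J. R. Schrieffer, Phys. Rev. 108 (1957) 1175, §II; C. N. Yang, Rev.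
Mod. Phys. 34 (1962) 694, §4; S. J. Gustafson, I. M. Sigal, *Mathematical Concepts of Quantum Mechanics* (2003),
§18.3 (Gibbs variational principle); T. Koma, H. Tasaki, Phys. Rev. Lett. 68 (1992) 3248 (no thermal pairing LRO
in `d ≤ 2` for finite-range models).
-/

noncomputable section

namespace Summit.Ventures.CertifiedManyBodySolver.Observables

open Literature.MathematicalPhysics.QuantumLattice Summit.Ventures.CertifiedManyBodySolver
open Matrix HubbardWave0 Literature.Probability.LatticeModels Finset
open scoped BigOperators ComplexOrder

/-- Same local instance as `Rows/SourcedTorusRows.lean` and `Observables/CrutchODLROFloor.lean`, so that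
`crutchTorusTT' L tp U μ g` / `.groundEnergy` / `gibbsState` elaborate with the SAME `DecidableEq` path as P1-GC (a
different path is propositionally equal but defeq-unification of the two chains does not terminate in practice). -/
local instance (priority := high) instDecidableEqFermionTorusCrutchThermal {L : ℕ} :
    DecidableEq (FermionTorus 2 L) :=
  LinearOrder.toDecidableEq

variable {L : ℕ} [NeZero L]

/-! ## §0 The thermal functional and the statement -/

variable (L) in
/-- Thermal pair-ODLRO density of the crutch Gibbs state at inverse temperature `β`:
`u_β(L, g) = Re ω_{β, H_g}(Δ_d†Δ_d) / L⁴`, `ω_{β,H}(X) = tr(e^{−βH} X)/tr e^{−βH}` (`Matrix.gibbsState`). -/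
def thermalPairLRO (tp U μ g β : ℝ) : ℝ :=
  (gibbsState β (crutchTorusTT' L tp U μ g) (pairSq L)).re / (L : ℝ) ^ 4

variable (L) in
/-- **P1-GC-β** (class = Fock space at one `μ`, one torus, inverse temperature `β`). From the two T = 0
cells — zero-field floor `lo·L² ≤ E₀(K_L − μN)` and sourced cap `E₀(A_L(h₀)) ≤ hi·L²` — for every `g > 0`
the crutch Gibbs state has thermal pair-ODLRO density `≥ (lo − hi − h₀²/g − (log 4)/β)/g`. -/
def CrutchThermalODLROFloorGC (tp U μ h0 β : ℝ) (lo hi : ℚ) : Prop :=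
  SourcedTorusEnergyLowerRow L tp U μ 0 lo → SourcedTorusEnergyUpperRow L tp U μ h0 hi →
    ∀ g : ℝ, 0 < g →
      (((lo : ℚ) : ℝ) - ((hi : ℚ) : ℝ) - h0 ^ 2 / g - Real.log 4 / β) / g ≤ thermalPairLRO L tp U μ g β

/-- Uniform-in-`L` form over the uniform cells (`∀ L ≥ L₀`, `q ∣ L`). -/
def CrutchThermalODLROFloorGCUniform (tp U μ h0 β : ℝ) (q L₀ : ℕ) (lo hi : ℚ) : Prop :=
  SourcedEnergyLowerRow tp U μ 0 q L₀ lo → SourcedEnergyUpperRow tp U μ h0 q L₀ hi →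
    ∀ (L : ℕ) [NeZero L], L₀ ≤ L → q ∣ L → ∀ g : ℝ, 0 < g →
      (((lo : ℚ) : ℝ) - ((hi : ℚ) : ℝ) - h0 ^ 2 / g - Real.log 4 / β) / g ≤ thermalPairLRO L tp U μ g β

/-! ## §1 Generic finite-dimensional facts -/

/-- A Gibbs state does not go below the ground energy of ANY Hermitian observable:
`E₀(X) ≤ Re ω_{β,H}(X)` (`X − E₀(X) ⪰ 0` and positivity of the Gibbs state; same statement as
`HubbardLadder.Bounds.groundEnergy_le_re_gibbsState` and as `Observables/SourcedGibbsTrialCap`'s `(β) (hA) (hB)` version; `private` copy to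
keep this file's imports light). -/
private theorem groundEnergy_observable_le_re_gibbsState {n : Type*} [Fintype n] [DecidableEq n] [Nonempty n]
    {H X : Matrix n n ℂ} (hH : H.IsHermitian) (hX : X.IsHermitian) (β : ℝ) :
    X.groundEnergy ≤ (gibbsState β H X).re := by
  have hpsd : (X - ((X.groundEnergy : ℝ) : ℂ) • (1 : Matrix n n ℂ)).PosSemidef := by
    have h := posSemidef_sub_groundEnergy hX
    rwa [Algebra.algebraMap_eq_smul_one, RCLike.real_smul_eq_coe_smul (K := ℂ)] at h
  have h0 := gibbsState_nonneg_of_posSemidef β hH hpsd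
  rw [map_sub, map_smul, gibbsState_one β H (partitionFn_pos β hH).ne', smul_eq_mul, mul_one] at h0
  obtain ⟨hre, -⟩ := Complex.nonneg_iff.mp h0
  rw [Complex.sub_re, Complex.ofReal_re] at hre
  linarith

/-- Energy–entropy bound at the ground energy: `Re ω_{β,H}(H) ≤ E₀(H) + log(dim)/β` (`β > 0`;
`Matrix.re_gibbsState_hamiltonian_le` at an argmin eigenvalue; same statement as
`HubbardLadder.Bounds.re_gibbsState_self_le_groundEnergy_add`; `private` copy). -/
private theorem re_gibbsState_self_le_groundEnergy_add_log_card {n : Type*} [Fintype n] [DecidableEq n] [Nonempty n]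
    {H : Matrix n n ℂ} (hH : H.IsHermitian) {β : ℝ} (hβ : 0 < β) :
    (gibbsState β H H).re ≤ H.groundEnergy + Real.log (Fintype.card n) / β := by
  obtain ⟨i₀, hi₀⟩ := exists_eq_ciInf_of_finite (f := hH.eigenvalues)
  have h := Matrix.re_gibbsState_hamiltonian_le hH hβ i₀
  rw [groundEnergy_eq_iInf_eigenvalues_holds hH, ← hi₀]
  exact h

/-- `dim Fock(torus of side L) = 4^{L²}` (all subsets of the `2L²` spin-orbitals). -/
theorem card_fock_index (L : ℕ) : Fintype.card (Finset (Orb (FermionTorus 2 L))) = 4 ^ (L ^ 2) := by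
  rw [Fintype.card_finset]
  have : Fintype.card (Orb (FermionTorus 2 L)) = 2 * L ^ 2 := by
    rw [card_orb]
    simp [FermionTorus, sq]
  rw [this, pow_mul]
  norm_num

/-- `log dim Fock = L² · log 4`. -/
theorem log_card_fock_index (L : ℕ) :
    Real.log (Fintype.card (Finset (Orb (FermionTorus 2 L)))) = (L : ℝ) ^ 2 * Real.log 4 := by
  rw [card_fock_index]; push_cast
  rw [Real.log_pow]; push_cast; ring

/-! ## §2 The thermal chain -/

/-- **Thermal Step B.** `Re ω_{β,g}(K − μN) = Re ω_{β,g}(H_g) + (g/L²)·Re ω_{β,g}(Δ_d†Δ_d)` (linearity). -/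
theorem re_gibbsState_zeroField_eq (tp U μ g β : ℝ) :
    (gibbsState β (crutchTorusTT' L tp U μ g) (dWaveSourceTorusTT' L tp U μ 0)).re =
      (gibbsState β (crutchTorusTT' L tp U μ g) (crutchTorusTT' L tp U μ g)).re +
        g / (L : ℝ) ^ 2 * (gibbsState β (crutchTorusTT' L tp U μ g) (pairSq L)).re := by
  have hsplit : dWaveSourceTorusTT' L tp U μ 0 =
      crutchTorusTT' L tp U μ g + ((g / (L : ℝ) ^ 2 : ℝ) : ℂ) • pairSq L := by
    rw [crutchTorusTT', sub_add_cancel]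
  rw [hsplit, map_add, map_smul, smul_eq_mul, Complex.add_re, Complex.mul_re, Complex.ofReal_re,
    Complex.ofReal_im, zero_mul, sub_zero]

/-- **P1-GC-β PROVED**: for every `g > 0`, `β > 0`, the thermal pair-ODLRO density of the crutch Gibbs state is
`≥ (lo − hi − h₀²/g − (log 4)/β)/g` given the two `T = 0` cells. Class: GC Fock space at one `μ`, one torus. -/
theorem crutchThermalODLROFloorGC_holds (tp U μ h0 : ℝ) {β : ℝ} (hβ : 0 < β) (lo hi : ℚ) :
    CrutchThermalODLROFloorGC L tp U μ h0 β lo hi := by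
  intro hlo hhi g hg
  have hL : (0 : ℝ) < (L : ℝ) := by exact_mod_cast Nat.pos_of_ne_zero (NeZero.ne L)
  have hL2 : (0 : ℝ) < (L : ℝ) ^ 2 := by positivity
  have hL4 : (0 : ℝ) < (L : ℝ) ^ 4 := by positivity
  set H := crutchTorusTT' L tp U μ g with hHdef
  have hH : H.IsHermitian := crutchTorusTT'_isHermitian (L := L) tp U μ g
  have hA0 : (dWaveSourceTorusTT' L tp U μ 0).IsHermitian := dWaveSourceTorusTT'_isHermitian L tp U μ 0
  -- (1) cell: lo L² ≤ E₀(A(0))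
  have h1 : ((lo : ℚ) : ℝ) * (L : ℝ) ^ 2 ≤ (dWaveSourceTorusTT' L tp U μ 0).groundEnergy := hlo
  -- (2) Gibbs state of H_g is a state: E₀(A(0)) ≤ Re ω(A(0))
  have h2 : (dWaveSourceTorusTT' L tp U μ 0).groundEnergy ≤
      (gibbsState β H (dWaveSourceTorusTT' L tp U μ 0)).re :=
    groundEnergy_observable_le_re_gibbsState hH hA0 β
  -- (3) linearity
  have h3 := re_gibbsState_zeroField_eq (L := L) tp U μ g β
  -- (4) energy–entropy bound for H_g
  have h4 : (gibbsState β H H).re ≤ H.groundEnergy + (L : ℝ) ^ 2 * Real.log 4 / β := by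
    have := re_gibbsState_self_le_groundEnergy_add_log_card hH hβ
    rwa [log_card_fock_index] at this
  -- (5) the square + cap cell: E₀(H_g) ≤ hi L² + h0² L²/g
  have h5 : H.groundEnergy ≤ ((hi : ℚ) : ℝ) * (L : ℝ) ^ 2 + h0 ^ 2 * (L : ℝ) ^ 2 / g := by
    have hsq := groundEnergy_crutch_le (crutchLeSourcedAdd_of_pos (L := L) tp U μ h0 hg)
    have hcap : (dWaveSourceTorusTT' L tp U μ h0).groundEnergy ≤ ((hi : ℚ) : ℝ) * (L : ℝ) ^ 2 := hhi
    linarith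
  -- combine: lo L² ≤ hi L² + h0² L²/g + L² log4/β + (g/L²) X
  set X := (gibbsState β H (pairSq L)).re with hX
  have hchain : ((lo : ℚ) : ℝ) * (L : ℝ) ^ 2 ≤
      ((hi : ℚ) : ℝ) * (L : ℝ) ^ 2 + h0 ^ 2 * (L : ℝ) ^ 2 / g + (L : ℝ) ^ 2 * Real.log 4 / β +
        g / (L : ℝ) ^ 2 * X := by
    rw [← hHdef] at h3
    linarith
  -- divide by g L²: floor ≤ X / L⁴
  unfold thermalPairLRO
  rw [← hHdef, ← hX]
  set F := ((lo : ℚ) : ℝ) - ((hi : ℚ) : ℝ) - h0 ^ 2 / g - Real.log 4 / β with hF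
  have key : F * (L : ℝ) ^ 2 ≤ g / (L : ℝ) ^ 2 * X := by
    have e1 : h0 ^ 2 * (L : ℝ) ^ 2 / g = h0 ^ 2 / g * (L : ℝ) ^ 2 := by ring
    have e2 : (L : ℝ) ^ 2 * Real.log 4 / β = Real.log 4 / β * (L : ℝ) ^ 2 := by ring
    rw [e1, e2] at hchain
    rw [hF]
    nlinarith
  have key2 : F ≤ g * (X / (L : ℝ) ^ 4) := by
    have hL2ne : (L : ℝ) ^ 2 ≠ 0 := hL2.ne'
    calc F = F * (L : ℝ) ^ 2 / (L : ℝ) ^ 2 := by field_simp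
      _ ≤ (g / (L : ℝ) ^ 2 * X) / (L : ℝ) ^ 2 := div_le_div_of_nonneg_right key hL2.le
      _ = g * (X / (L : ℝ) ^ 4) := by field_simp
  rwa [div_le_iff₀' hg]

/-- **P1-GC-β, uniform in `L`, PROVED.** -/
theorem crutchThermalODLROFloorGCUniform_holds (tp U μ h0 : ℝ) {β : ℝ} (hβ : 0 < β) (q L₀ : ℕ)
    (lo hi : ℚ) : CrutchThermalODLROFloorGCUniform tp U μ h0 β q L₀ lo hi := by
  intro hlo hhi L _ hL hq g hg
  exact crutchThermalODLROFloorGC_holds (L := L) tp U μ h0 hβ lo hi (hlo L hL hq) (hhi L hL hq) g hg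

/-- **By-name reader** (corollary column, T > 0): a zero-field floor cell on `(q₁, L₁)` and a sourced cap
cell at `h₀` on `(q₂, L₂)` give the thermal crutch floor on every torus both cells reach, every `β > 0`. -/
theorem crutchThermalODLROFloor_of_rows {tp U μ h0 : ℝ} {q₁ q₂ L₁ L₂ : ℕ} {lo hi : ℚ}
    (hlo : SourcedEnergyLowerRow tp U μ 0 q₁ L₁ lo) (hhi : SourcedEnergyUpperRow tp U μ h0 q₂ L₂ hi)
    (L : ℕ) [NeZero L] (hL₁ : L₁ ≤ L) (hL₂ : L₂ ≤ L) (hq₁ : q₁ ∣ L) (hq₂ : q₂ ∣ L)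
    {g β : ℝ} (hg : 0 < g) (hβ : 0 < β) :
    (((lo : ℚ) : ℝ) - ((hi : ℚ) : ℝ) - h0 ^ 2 / g - Real.log 4 / β) / g ≤ thermalPairLRO L tp U μ g β :=
  crutchThermalODLROFloorGC_holds (L := L) tp U μ h0 hβ lo hi (hlo L hL₁ hq₁) (hhi L hL₂ hq₂) g hg

/-! ## §3 Corollary-column arithmetic (pure `ℝ`) -/

/-- The thermal floor is positive iff `G − log 4/β > 0` and `g > h₀²/(G − log 4/β)`, `G = lo − hi`:
i.e. for `β > log 4 / G` the threshold is `g₀(β) = h₀²/(G − log 4/β)` (`↓ g₀ = h₀²/G` as `β → ∞`). -/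
theorem thermalCrutchFloor_pos_iff {G g h0 β : ℝ} (hGβ : 0 < G - Real.log 4 / β) (hg : 0 < g) :
    0 < (G - h0 ^ 2 / g - Real.log 4 / β) / g ↔ h0 ^ 2 / (G - Real.log 4 / β) < g := by
  rw [div_pos_iff_of_pos_right hg, div_lt_iff₀ hGβ]
  constructor
  · intro h
    have : h0 ^ 2 / g < G - Real.log 4 / β := by linarith
    rwa [div_lt_iff₀ hg, mul_comm] at this
  · intro h
    have : h0 ^ 2 / g < G - Real.log 4 / β := by
      rw [div_lt_iff₀ hg]; linarith [mul_comm g (G - Real.log 4 / β)]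
    linarith

/-- Equivalently, at fixed `g > g₀ = h₀²/G` the floor is positive for every `β > log 4 / (G − h₀²/g)`:
the crutch model has certified thermal pair ODLRO for all temperatures `T < (G − h₀²/g)/log 4`. -/
theorem thermalCrutchFloor_pos_of_beta {G g h0 β : ℝ} (hg : 0 < g) (hβ : 0 < β)
    (hmargin : 0 < G - h0 ^ 2 / g) (hT : Real.log 4 / (G - h0 ^ 2 / g) < β) :
    0 < (G - h0 ^ 2 / g - Real.log 4 / β) / g := by
  refine div_pos ?_ hg
  have h4 : 0 < Real.log 4 := Real.log_pos (by norm_num)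
  have : Real.log 4 / β < G - h0 ^ 2 / g := by
    rw [div_lt_iff₀ hβ]
    have := (div_lt_iff₀ hmargin).1 hT
    linarith [mul_comm β (G - h0 ^ 2 / g)]
  linarith

end Summit.Ventures.CertifiedManyBodySolver.Observables
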